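/-
Copyright: the b2b-balaban T⁴-continuum CRUX team, row NE7b OWNER lineage `t4-ne7b-p1` (gen 136). Project licence.
-/
import Summits.QuantumFields.BalabanUV.T4Continuum.Spine.NE7b.SupBlockThirdLetter
import Summits.QuantumFields.BalabanUV.T4Continuum.Spine.NE7b.SupDressedConstantBounds

/-!
# THE BLOCK TILTED GRADIENT MOMENTS ON THE ROAD — (329)∕(339)'s BLOCK TWIN: for a `C¹` block potential `U` with stability `−κ₀Σ_Yφ² ≤ U`,
# the gradient letter `‖U′(φ)‖ ≤ κ₁(a + Σ_Yφ²)` and the UPPER GROWTH letter `U(φ) ≤ κ_u(a_u + Σ_Yφ²)`, over `N(0,Γ)` with `Γ ⪯ γ_op·1`,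
# `Γ(y,y) ≤ γ` on `Y`, `(2κ₀(1+τ)+4δ)γ_op ≤ θ < 1`: at EVERY background `ψ` with `Σ_Yψ² ≤ S`,
#   `∫e^{−U(ω+ψ)}‖U′(ω+ψ)‖ᵏ dN(0,Γ) ≤ κ₁ᵏP_k(S)e^{κ₀(1+τ⁻¹)S}·A^{#Y}`  (`k = 1,2,3`; `P₁ = (a+2S)+δ⁻¹`, `P₂ = 2(a+2S)²+8δ⁻²`, `P₃ = 4(a+2S)³+32δ⁻³`,
#   `A = (1−θ)^{−(2κ₀(1+τ)+4δ)γ∕(2θ)}` by (288)),   `Z(ψ) = ∫e^{−U(ω+ψ)} ≥ e^{−κ_u(a_u + Σ_YΓ_yy + S)}`  (Jensen)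
# ⟹ THE BLOCK TILTED GRADIENT-MOMENT LETTERS `∫e^{−U}‖U′‖ᵏ ≤ Z·m_k(S)` of (406) HOLD with `m_k(S) = κ₁ᵏP_k(S)e^{κ₀(1+τ⁻¹)S}A^{#Y}e^{κ_u(a_u+Σ_YΓ_yy+S)}`,
# functions of `S` alone — uniform in the volume and on every segment `ψ₀ + th`, `t ∈ [0,1]` with `S = 2Σ_Yψ₀² + 2Σ_Yh²`, so (406)'s cubic
# Taylor letter of the next potential of a block input holds UNCONDITIONALLY ON THE ROAD (row NE7b, node U5c; (288)∕(396)∕(399)∕(405)∕(406)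
# BY NAME; [folklore])

Cell `pub-balaban`, sub-cell `t4`, spine estimate NE7b (`T4WeightBudget.RelWeightBound`; the cell's OWN estimate — NOT PRINTED in
[Bałaban 1983–89], NOT PROVED).  Crux-route work under `Spine/NE7b/` by the row OWNER (`t4-ne7b-p1` gen 136, file (407)) under FREEZE
(0)'s crux-prover clause, on this gen's SCOPING-d8 DECISION (d8′)(2); NOTHING of Bałaban's is named as a Lean object, valued or asserted;
no `T4Continuum/Support` leaf typed; no `def`, no notation; zero `sorry`.  Imports (BY NAME): the OWNER's (406) `…SupBlockThirdLetter`
(`block_cubic_taylor`), (396) `…SupDressedConstantBounds` (`integrable_eval_mul_eval`, `integrable_eval`, `integral_eval_eq_zero`,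
`integral_eval_mul_eval`) and through them (405) (`lin_le_exp`, `cube_le_exp`), (399) (`neg_block_le`, `integrable_exp_neg_block`), (292)
(`sum_add_sq_le`), (313) (`mul_opBound_le_of_le`), (288) (`integral_exp_half_sq_on_le`, `integrable_exp_half_sq_on`); Mathlib's
`ConvexOn.map_integral_le` (Jensen), `Real.pow_div_factorial_le_exp`.

WHAT IS PROVED ([folklore]): §1 `sq_le_exp`, `block_moment_pointwise` (the three tilted-moment integrands under the common Gaussian dominator);
§2 `block_moments_le` (integrability and `∫e^{−U}‖U′‖ᵏ ≤ κ₁ᵏP_ke^{κ₀(1+τ⁻¹)S}A^{#Y}`); §3 `integrable_block_action`, `blockZ_lower` (Jensen: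
`e^{−κ_u(a_u+Σ_YΓ_yy+S)} ≤ Z(ψ)`); §4 THE END **`block_tilted_gradient_moments`** (the three letters `∫e^{−U}‖U′‖ᵏ ≤ Z·m_k(S)`), `sum_sq_segment_le`,
**`block_cubic_taylor_road`** ((406)'s cubic Taylor letter with the moment letters DISCHARGED, `S = 2Σ_Yψ₀² + 2Σ_Yh²`); toy.

HONEST (what this is NOT).  Crude moments from the block letters (the constants grow like `e^{O(S)}` in the background size `S` — a
small-field statement; no large-field∕KP bookkeeping for blocks here); the re-run of (386)∕(389)∕(391)∕(394) with `U` in place of `Σw`,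
(β3′) and (β4) remain; scalar skeleton ((A3), NC-NE7b-α UNRULED); nothing of Bałaban's asserted.  BY-NAME EFFECT ON THE WALL: NONE.  NE7b NOT
PRINTED ∕ NOT PROVED; spine PROVED 0∕9; rung (B)+1 — the programme's measures remain FINITE-torus statements; NOT the mass gap, NOT Clay.
HONEST DEPENDENCY: continuum YM on T⁴ ⇐ BetaPertH ∧ nine spine estimates (0∕9 proved); BetaPertH ⇐ (D1) ∧ (D4) ∧ CAP+tail; G-an2-4 gates
asym, D1 and NE2∕3∕4.
-/

set_option autoImplicit false
set_option maxSynthPendingDepth 2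

noncomputable section

namespace Summit.QuantumFields.BalabanUV.T4Continuum.NE7b.SupBlockTiltedGradientMoments

open MeasureTheory ProbabilityTheory Finset Real Set
open scoped BigOperators
open SupGaussianRegulator (integral_exp_half_sq_on_le integrable_exp_half_sq_on)
open SupBlockEffectiveActionDerivative (neg_block_le integrable_exp_neg_block)
open SupRegulatedActivityShift (sum_add_sq_le)
open SupEffectiveActionDerivative (mul_opBound_le_of_le)
open SupBlockStepLineDerivatives (lin_le_exp cube_le_exp)
open SupDressedConstantBounds (integrable_eval_mul_eval integrable_eval integral_eval_eq_zero integral_eval_mul_eval)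
open SupBlockThirdLetter (block_cubic_taylor)

variable {ι : Type} [Fintype ι] [DecidableEq ι]

/-! ## §1. The tilted-moment integrands under the common dominator -/

/-- `S² ≤ (δ²)⁻¹·e^{2δS}` for `δ > 0`, `S ≥ 0` (from `x²∕2! ≤ eˣ`). [folklore] -/
theorem sq_le_exp {δ S : ℝ} (hδ : 0 < δ) (hS : 0 ≤ S) : S ^ 2 ≤ (δ ^ 2)⁻¹ * exp (2 * δ * S) := by
  have h := Real.pow_div_factorial_le_exp (x := 2 * δ * S) (by positivity) 2
  have e2 : ((Nat.factorial 2 : ℕ) : ℝ) = 2 := by norm_num [Nat.factorial]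
  rw [e2] at h; have h1 : δ ^ 2 * S ^ 2 ≤ exp (2 * δ * S) := by nlinarith [pow_nonneg hδ.le 2, pow_nonneg hS 2]
  rw [le_inv_mul_iff₀' (pow_pos hδ 2), mul_comm]; exact h1

section Main

variable {Γ : Matrix ι ι ℝ} {γop γ : ℝ} {U : EuclideanSpace ℝ ι → ℝ} {U' : EuclideanSpace ℝ ι → EuclideanSpace ℝ ι →L[ℝ] ℝ}
  {U'' : EuclideanSpace ℝ ι → EuclideanSpace ℝ ι →L[ℝ] EuclideanSpace ℝ ι →L[ℝ] ℝ}
  {U₃ : EuclideanSpace ℝ ι → EuclideanSpace ℝ ι →L[ℝ] EuclideanSpace ℝ ι →L[ℝ] EuclideanSpace ℝ ι →L[ℝ] ℝ} {κ₀ κ₁ κ₂ κ₃ a κu au τ δ θ S : ℝ}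

omit [DecidableEq ι] in
/-- **THE THREE TILTED-MOMENT INTEGRANDS ARE UNDER THE COMMON DOMINATOR**: stability, the gradient letter, `0 < τ, δ`, `Σ_Yψ² ≤ S` ⟹
`e^{−U(ω+ψ)}‖U′(ω+ψ)‖ᵏ ≤ κ₁ᵏP_k(S)e^{κ₀(1+τ⁻¹)S}·e^{½(2κ₀(1+τ)+4δ)Σ_Yω²}` for `k = 1, 2, 3`. [folklore] -/
theorem block_moment_pointwise (Y : Finset ι) (hκ₀ : 0 ≤ κ₀) (hκ₁ : 0 ≤ κ₁) (ha : 0 ≤ a) (hτ : 0 < τ) (hδ : 0 < δ)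
    (hstab : ∀ φ : EuclideanSpace ℝ ι, -(κ₀ * ∑ x ∈ Y, φ x ^ 2) ≤ U φ)
    (hU'b : ∀ φ : EuclideanSpace ℝ ι, ‖U' φ‖ ≤ κ₁ * (a + ∑ x ∈ Y, φ x ^ 2)) (ψ : EuclideanSpace ℝ ι) (hS : ∑ x ∈ Y, ψ x ^ 2 ≤ S)
    (ω : EuclideanSpace ℝ ι) :
    exp (-U (ω + ψ)) * ‖U' (ω + ψ)‖ ≤ (κ₁ * ((a + 2 * S) + δ⁻¹) * exp (κ₀ * (1 + τ⁻¹) * S)) * exp ((2 * κ₀ * (1 + τ) + 4 * δ) * (∑ x ∈ Y, ω x ^ 2) / 2) ∧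
      exp (-U (ω + ψ)) * ‖U' (ω + ψ)‖ ^ 2 ≤ (κ₁ ^ 2 * (2 * (a + 2 * S) ^ 2 + 8 * (δ ^ 2)⁻¹) * exp (κ₀ * (1 + τ⁻¹) * S)) * exp ((2 * κ₀ * (1 + τ) + 4 * δ) * (∑ x ∈ Y, ω x ^
          2) / 2) ∧
      exp (-U (ω + ψ)) * ‖U' (ω + ψ)‖ ^ 3 ≤ (κ₁ ^ 3 * (4 * (a + 2 * S) ^ 3 + 32 * (δ ^ 3)⁻¹) * exp (κ₀ * (1 + τ⁻¹) * S)) * exp ((2 * κ₀ * (1 + τ) + 4 * δ) * (∑ x ∈ Y, ω x ^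
          2) / 2) := by
  set Sω : ℝ := ∑ x ∈ Y, ω x ^ 2 with hSω
  have hSω0 : 0 ≤ Sω := sum_nonneg fun x _ => sq_nonneg _
  have hS0 : 0 ≤ S := (sum_nonneg fun x _ => sq_nonneg (ψ x)).trans hS
  set c : ℝ := a + 2 * S with hc
  have hc0 : 0 ≤ c := by rw [hc]; positivity
  -- the exponent: stability + Young, then `Σ_Yψ² ≤ S`
  have hV : -U (ω + ψ) ≤ κ₀ * (1 + τ) * Sω + κ₀ * (1 + τ⁻¹) * S := by
    have h := neg_block_le Y hκ₀ hτ hstab ω ψ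
    have h2 : κ₀ * (1 + τ⁻¹) * ∑ x ∈ Y, ψ x ^ 2 ≤ κ₀ * (1 + τ⁻¹) * S := mul_le_mul_of_nonneg_left hS (by positivity)
    linarith
  have hE : exp (-U (ω + ψ)) ≤ exp (κ₀ * (1 + τ) * Sω + κ₀ * (1 + τ⁻¹) * S) := exp_le_exp.2 hV
  -- the gradient: `‖U′(ω+ψ)‖ ≤ κ₁(c + 2Σω²)`
  set q : ℝ := c + 2 * Sω with hq
  have hq0 : 0 ≤ q := by rw [hq]; positivity
  have hD : ‖U' (ω + ψ)‖ ≤ κ₁ * q := by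
    have hsum : ∑ x ∈ Y, (ω + ψ) x ^ 2 ≤ 2 * Sω + 2 * S := by
      have h := sum_add_sq_le Y (fun x => ω x) (fun x => ψ x) one_pos
      have e : ∑ x ∈ Y, (ω + ψ) x ^ 2 = ∑ x ∈ Y, (ω x + ψ x) ^ 2 := sum_congr rfl fun x _ => by simp
      rw [e]; norm_num at h; linarith
    refine (hU'b (ω + ψ)).trans (mul_le_mul_of_nonneg_left ?_ hκ₁)
    rw [hq, hc]; linarith
  have hn0 : 0 ≤ ‖U' (ω + ψ)‖ := norm_nonneg _
  -- the three polynomial prefactors under one exponential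
  have he1 : 1 ≤ exp (2 * δ * Sω) := one_le_exp_iff.2 (by positivity)
  have hq1 : q ≤ (c + δ⁻¹) * exp (2 * δ * Sω) := by
    have h3 := lin_le_exp hδ Sω
    have h4 : c ≤ c * exp (2 * δ * Sω) := le_mul_of_one_le_right hc0 he1
    rw [hq]; nlinarith
  have hq2 : q ^ 2 ≤ (2 * c ^ 2 + 8 * (δ ^ 2)⁻¹) * exp (2 * δ * Sω) := by
    have h1 : (c + 2 * Sω) ^ 2 ≤ 2 * c ^ 2 + 8 * Sω ^ 2 := by nlinarith [sq_nonneg (c - 2 * Sω)]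
    have h2 := sq_le_exp hδ hSω0
    have h4 : c ^ 2 ≤ c ^ 2 * exp (2 * δ * Sω) := le_mul_of_one_le_right (pow_nonneg hc0 2) he1
    rw [hq]; nlinarith [pow_nonneg hc0 2]
  have hq3 : q ^ 3 ≤ (4 * c ^ 3 + 32 * (δ ^ 3)⁻¹) * exp (2 * δ * Sω) := by
    have h1 : (c + 2 * Sω) ^ 3 ≤ 4 * (c ^ 3 + (2 * Sω) ^ 3) := by   -- `(p+q)³ ≤ 4(p³+q³)` (the tree's `add_pow_three_le`, inlined)
      nlinarith [mul_nonneg (add_nonneg hc0 (show 0 ≤ 2 * Sω by positivity)) (sq_nonneg (c - 2 * Sω)), mul_nonneg hc0 hSω0]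
    have h2 := cube_le_exp hδ hSω0
    have h4 : c ^ 3 ≤ c ^ 3 * exp (2 * δ * Sω) := le_mul_of_one_le_right (pow_nonneg hc0 3) he1
    have e8 : (2 * Sω) ^ 3 = 8 * Sω ^ 3 := by ring
    rw [e8] at h1; rw [hq]; nlinarith [pow_nonneg hc0 3]
  -- combining the two exponentials
  have he : exp (κ₀ * (1 + τ) * Sω + κ₀ * (1 + τ⁻¹) * S) * exp (2 * δ * Sω) =
      exp (κ₀ * (1 + τ⁻¹) * S) * exp ((2 * κ₀ * (1 + τ) + 4 * δ) * Sω / 2) := by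
    rw [← exp_add, ← exp_add]; congr 1; ring
  have hE0 : 0 ≤ exp (-U (ω + ψ)) := (exp_pos _).le
  have hn1 : ‖U' (ω + ψ)‖ ≤ κ₁ * ((c + δ⁻¹) * exp (2 * δ * Sω)) := hD.trans (mul_le_mul_of_nonneg_left hq1 hκ₁)
  have hn2 : ‖U' (ω + ψ)‖ ^ 2 ≤ κ₁ ^ 2 * ((2 * c ^ 2 + 8 * (δ ^ 2)⁻¹) * exp (2 * δ * Sω)) := by
    have h := pow_le_pow_left₀ hn0 hD 2
    rw [mul_pow] at h; exact h.trans (mul_le_mul_of_nonneg_left hq2 (pow_nonneg hκ₁ 2))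
  have hn3 : ‖U' (ω + ψ)‖ ^ 3 ≤ κ₁ ^ 3 * ((4 * c ^ 3 + 32 * (δ ^ 3)⁻¹) * exp (2 * δ * Sω)) := by
    have h := pow_le_pow_left₀ hn0 hD 3
    rw [mul_pow] at h; exact h.trans (mul_le_mul_of_nonneg_left hq3 (pow_nonneg hκ₁ 3))
  refine ⟨?_, ?_, ?_⟩
  · calc exp (-U (ω + ψ)) * ‖U' (ω + ψ)‖ ≤ exp (κ₀ * (1 + τ) * Sω + κ₀ * (1 + τ⁻¹) * S) * (κ₁ * ((c + δ⁻¹) * exp (2 * δ * Sω))) :=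
          mul_le_mul hE hn1 hn0 (exp_pos _).le
      _ = (κ₁ * (c + δ⁻¹) * exp (κ₀ * (1 + τ⁻¹) * S)) * exp ((2 * κ₀ * (1 + τ) + 4 * δ) * Sω / 2) := by
          calc _ = κ₁ * (c + δ⁻¹) * (exp (κ₀ * (1 + τ) * Sω + κ₀ * (1 + τ⁻¹) * S) * exp (2 * δ * Sω)) := by ring
            _ = _ := by rw [he]; ring
  · calc exp (-U (ω + ψ)) * ‖U' (ω + ψ)‖ ^ 2 ≤ exp (κ₀ * (1 + τ) * Sω + κ₀ * (1 + τ⁻¹) * S) * (κ₁ ^ 2 * ((2 * c ^ 2 + 8 * (δ ^ 2)⁻¹) * exp (2 * δ * Sω))) :=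
          mul_le_mul hE hn2 (pow_nonneg hn0 2) (exp_pos _).le
      _ = (κ₁ ^ 2 * (2 * c ^ 2 + 8 * (δ ^ 2)⁻¹) * exp (κ₀ * (1 + τ⁻¹) * S)) * exp ((2 * κ₀ * (1 + τ) + 4 * δ) * Sω / 2) := by
          calc _ = κ₁ ^ 2 * (2 * c ^ 2 + 8 * (δ ^ 2)⁻¹) * (exp (κ₀ * (1 + τ) * Sω + κ₀ * (1 + τ⁻¹) * S) * exp (2 * δ * Sω)) := by ring
            _ = _ := by rw [he]; ring
  · calc exp (-U (ω + ψ)) * ‖U' (ω + ψ)‖ ^ 3 ≤ exp (κ₀ * (1 + τ) * Sω + κ₀ * (1 + τ⁻¹) * S) * (κ₁ ^ 3 * ((4 * c ^ 3 + 32 * (δ ^ 3)⁻¹) * exp (2 * δ * Sω))) :=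
          mul_le_mul hE hn3 (pow_nonneg hn0 3) (exp_pos _).le
      _ = (κ₁ ^ 3 * (4 * c ^ 3 + 32 * (δ ^ 3)⁻¹) * exp (κ₀ * (1 + τ⁻¹) * S)) * exp ((2 * κ₀ * (1 + τ) + 4 * δ) * Sω / 2) := by
          calc _ = κ₁ ^ 3 * (4 * c ^ 3 + 32 * (δ ^ 3)⁻¹) * (exp (κ₀ * (1 + τ) * Sω + κ₀ * (1 + τ⁻¹) * S) * exp (2 * δ * Sω)) := by ring
            _ = _ := by rw [he]; ring

/-! ## §2. The tilted moments are finite, multiplicatively in `#Y` -/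

/-- **THE BLOCK TILTED GRADIENT MOMENTS**: `Γ ⪰ 0`, `Γ ⪯ γ_op·1`, `Γ(y,y) ≤ γ` on `Y`, `U ∈ C¹` (`U′` continuous) with stability and the gradient
letter, `0 < τ, δ`, `0 < θ < 1`, `(2κ₀(1+τ)+4δ)γ_op ≤ θ`, `Σ_Yψ² ≤ S` ⟹ for `k = 1,2,3` the integrand `e^{−U(ω+ψ)}‖U′(ω+ψ)‖ᵏ` is integrable and
`∫e^{−U(ω+ψ)}‖U′(ω+ψ)‖ᵏ dN(0,Γ) ≤ κ₁ᵏP_k(S)e^{κ₀(1+τ⁻¹)S}·A^{#Y}`, `A = (1−θ)^{−(2κ₀(1+τ)+4δ)γ∕(2θ)}`. [folklore] -/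
theorem block_moments_le (hΓ : Γ.PosSemidef) (hΓop : (γop • (1 : Matrix ι ι ℝ) - Γ).PosSemidef) (Y : Finset ι)
    (hdiag : ∀ i ∈ Y, Γ i i ≤ γ) (hUd : ∀ φ : EuclideanSpace ℝ ι, HasFDerivAt U (U' φ) φ) (hU'c : Continuous U')
    (hκ₀ : 0 ≤ κ₀) (hκ₁ : 0 ≤ κ₁) (ha : 0 ≤ a) (hτ : 0 < τ) (hδ : 0 < δ) (hθ0 : 0 < θ) (hθ1 : θ < 1)
    (hκθ : (2 * κ₀ * (1 + τ) + 4 * δ) * γop ≤ θ) (hstab : ∀ φ : EuclideanSpace ℝ ι, -(κ₀ * ∑ x ∈ Y, φ x ^ 2) ≤ U φ)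
    (hU'b : ∀ φ : EuclideanSpace ℝ ι, ‖U' φ‖ ≤ κ₁ * (a + ∑ x ∈ Y, φ x ^ 2)) (ψ : EuclideanSpace ℝ ι) (hS : ∑ x ∈ Y, ψ x ^ 2 ≤ S) :
    (Integrable (fun ω : EuclideanSpace ℝ ι => exp (-U (ω + ψ)) * ‖U' (ω + ψ)‖) (multivariateGaussian 0 Γ) ∧
        (∫ ω : EuclideanSpace ℝ ι, exp (-U (ω + ψ)) * ‖U' (ω + ψ)‖ ∂(multivariateGaussian 0 Γ)) ≤ (κ₁ * ((a + 2 * S) + δ⁻¹) * exp (κ₀ * (1 + τ⁻¹) * S)) * ((1 - θ) ^ (-((2 *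
            κ₀ * (1 + τ) + 4 * δ) * γ / (2 * θ)))) ^ Y.card) ∧
      (Integrable (fun ω : EuclideanSpace ℝ ι => exp (-U (ω + ψ)) * ‖U' (ω + ψ)‖ ^ 2) (multivariateGaussian 0 Γ) ∧
        (∫ ω : EuclideanSpace ℝ ι, exp (-U (ω + ψ)) * ‖U' (ω + ψ)‖ ^ 2 ∂(multivariateGaussian 0 Γ)) ≤ (κ₁ ^ 2 * (2 * (a + 2 * S) ^ 2 + 8 * (δ ^ 2)⁻¹) * exp (κ₀ * (1 + τ⁻¹)
            * S)) * ((1 - θ) ^ (-((2 * κ₀ * (1 + τ) + 4 * δ) * γ / (2 * θ)))) ^ Y.card) ∧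
      (Integrable (fun ω : EuclideanSpace ℝ ι => exp (-U (ω + ψ)) * ‖U' (ω + ψ)‖ ^ 3) (multivariateGaussian 0 Γ) ∧
        (∫ ω : EuclideanSpace ℝ ι, exp (-U (ω + ψ)) * ‖U' (ω + ψ)‖ ^ 3 ∂(multivariateGaussian 0 Γ)) ≤ (κ₁ ^ 3 * (4 * (a + 2 * S) ^ 3 + 32 * (δ ^ 3)⁻¹) * exp (κ₀ * (1 + τ⁻¹)
            * S)) * ((1 - θ) ^ (-((2 * κ₀ * (1 + τ) + 4 * δ) * γ / (2 * θ)))) ^ Y.card) := by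
  have hUc : Continuous U := continuous_iff_continuousAt.2 fun φ => (hUd φ).continuousAt
  have hsh : Continuous fun ω : EuclideanSpace ℝ ι => ω + ψ := continuous_id.add continuous_const
  have hEc : Continuous fun ω : EuclideanSpace ℝ ι => exp (-U (ω + ψ)) := continuous_exp.comp ((hUc.comp hsh).neg)
  have hNc : Continuous fun ω : EuclideanSpace ℝ ι => ‖U' (ω + ψ)‖ := continuous_norm.comp (hU'c.comp hsh)
  have hκ : 0 ≤ 2 * κ₀ * (1 + τ) + 4 * δ := by positivity
  have hdom := integrable_exp_half_sq_on hΓ hΓop hκ hθ1 hκθ Y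
  have hA := integral_exp_half_sq_on_le hΓ hΓop hκ hθ0 hθ1 hκθ Y hdiag
  have hpw := fun ω => block_moment_pointwise Y hκ₀ hκ₁ ha hτ hδ hstab hU'b ψ hS ω
  have hK1 : 0 ≤ (κ₁ * ((a + 2 * S) + δ⁻¹) * exp (κ₀ * (1 + τ⁻¹) * S)) := by
    have hS0 : 0 ≤ S := (sum_nonneg fun x _ => sq_nonneg (ψ x)).trans hS
    positivity
  have hK2 : 0 ≤ (κ₁ ^ 2 * (2 * (a + 2 * S) ^ 2 + 8 * (δ ^ 2)⁻¹) * exp (κ₀ * (1 + τ⁻¹) * S)) := by positivity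
  have hK3 : 0 ≤ (κ₁ ^ 3 * (4 * (a + 2 * S) ^ 3 + 32 * (δ ^ 3)⁻¹) * exp (κ₀ * (1 + τ⁻¹) * S)) := by
    have hS0 : 0 ≤ S := (sum_nonneg fun x _ => sq_nonneg (ψ x)).trans hS
    positivity
  have key : ∀ (k : ℕ) (Kc : ℝ), 0 ≤ Kc →
      (∀ ω : EuclideanSpace ℝ ι, exp (-U (ω + ψ)) * ‖U' (ω + ψ)‖ ^ k ≤ Kc * exp ((2 * κ₀ * (1 + τ) + 4 * δ) * (∑ x ∈ Y, ω x ^ 2) / 2)) →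
      Integrable (fun ω : EuclideanSpace ℝ ι => exp (-U (ω + ψ)) * ‖U' (ω + ψ)‖ ^ k) (multivariateGaussian 0 Γ) ∧
        (∫ ω : EuclideanSpace ℝ ι, exp (-U (ω + ψ)) * ‖U' (ω + ψ)‖ ^ k ∂(multivariateGaussian 0 Γ)) ≤ Kc * ((1 - θ) ^ (-((2 * κ₀ * (1 + τ) + 4 * δ) * γ / (2 * θ)))) ^
            Y.card := fun k Kc hKc hb => by
    have hnn : ∀ ω : EuclideanSpace ℝ ι, 0 ≤ exp (-U (ω + ψ)) * ‖U' (ω + ψ)‖ ^ k := fun ω => mul_nonneg (exp_pos _).le (pow_nonneg (norm_nonneg _) k)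
    have hint : Integrable (fun ω : EuclideanSpace ℝ ι => exp (-U (ω + ψ)) * ‖U' (ω + ψ)‖ ^ k) (multivariateGaussian 0 Γ) :=
      (hdom.const_mul Kc).mono' ((hEc.mul (hNc.pow k)).aestronglyMeasurable) (ae_of_all _ fun ω => by
        rw [Real.norm_eq_abs, abs_of_nonneg (hnn ω)]; exact hb ω)
    refine ⟨hint, ?_⟩
    calc (∫ ω : EuclideanSpace ℝ ι, exp (-U (ω + ψ)) * ‖U' (ω + ψ)‖ ^ k ∂(multivariateGaussian 0 Γ))
        ≤ ∫ ω : EuclideanSpace ℝ ι, Kc * exp ((2 * κ₀ * (1 + τ) + 4 * δ) * (∑ x ∈ Y, ω x ^ 2) / 2) ∂(multivariateGaussian 0 Γ) :=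
          integral_mono hint (hdom.const_mul Kc) hb
      _ ≤ Kc * ((1 - θ) ^ (-((2 * κ₀ * (1 + τ) + 4 * δ) * γ / (2 * θ)))) ^ Y.card := by rw [integral_const_mul]; exact mul_le_mul_of_nonneg_left hA hKc
  have k1 := key 1 _ hK1 (fun ω => by rw [pow_one]; exact (hpw ω).1)
  simp only [pow_one] at k1
  exact ⟨k1, key 2 _ hK2 (fun ω => (hpw ω).2.1), key 3 _ hK3 (fun ω => (hpw ω).2.2)⟩

/-! ## §3. Jensen: the step integral is bounded below -/

/-- **The block action is integrable** under `N(0,Γ)`: `U` continuous with `−κ₀Σ_Yφ² ≤ U(φ) ≤ κ_u(a_u + Σ_Yφ²)` (second moments). [folklore] -/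
theorem integrable_block_action (Γ : Matrix ι ι ℝ) (Y : Finset ι) (hUc : Continuous U) (hκ₀ : 0 ≤ κ₀) (hκu : 0 ≤ κu) (hau : 0 ≤ au)
    (hstab : ∀ φ : EuclideanSpace ℝ ι, -(κ₀ * ∑ x ∈ Y, φ x ^ 2) ≤ U φ)
    (hUup : ∀ φ : EuclideanSpace ℝ ι, U φ ≤ κu * (au + ∑ x ∈ Y, φ x ^ 2)) (ψ : EuclideanSpace ℝ ι) :
    Integrable (fun ω : EuclideanSpace ℝ ι => ∑ x ∈ Y, (ω + ψ) x ^ 2) (multivariateGaussian 0 Γ) ∧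
      Integrable (fun ω : EuclideanSpace ℝ ι => U (ω + ψ)) (multivariateGaussian 0 Γ) := by
  have hsq : ∀ x, Integrable (fun ω : EuclideanSpace ℝ ι => (ω + ψ) x ^ 2) (multivariateGaussian 0 Γ) := fun x => by
    have e : (fun ω : EuclideanSpace ℝ ι => (ω + ψ) x ^ 2) = fun ω => ω x * ω x + (2 * ψ x) * ω x + ψ x ^ 2 := by
      funext ω; simp only [PiLp.add_apply]; ring
    rw [e]
    exact ((integrable_eval_mul_eval Γ x x).add ((integrable_eval Γ x).const_mul _)).add (integrable_const _)
  have hQ : Integrable (fun ω : EuclideanSpace ℝ ι => ∑ x ∈ Y, (ω + ψ) x ^ 2) (multivariateGaussian 0 Γ) := integrable_finsetSum Y fun x _ => hsq x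
  refine ⟨hQ, ?_⟩
  have hB : Integrable (fun ω : EuclideanSpace ℝ ι => (κ₀ + κu) * (∑ x ∈ Y, (ω + ψ) x ^ 2) + κu * au) (multivariateGaussian 0 Γ) :=
    (hQ.const_mul (κ₀ + κu)).add (integrable_const (κu * au))
  refine hB.mono' ((hUc.comp (continuous_id.add continuous_const)).aestronglyMeasurable) (ae_of_all _ fun ω => ?_)
  have h1 := hstab (ω + ψ); have h2 := hUup (ω + ψ)
  have hQ0 : 0 ≤ ∑ x ∈ Y, (ω + ψ) x ^ 2 := sum_nonneg fun x _ => sq_nonneg _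
  rw [Real.norm_eq_abs]; refine abs_le.2 ⟨?_, ?_⟩ <;> nlinarith

/-- **JENSEN — THE STEP INTEGRAL IS BOUNDED BELOW**: `Γ ⪰ 0`, the two-sided growth of `U`, `e^{−U(ω+ψ)}` integrable, `Σ_Yψ² ≤ S` ⟹
`e^{−κ_u(a_u + Σ_YΓ(y,y) + S)} ≤ Z(ψ) = ∫e^{−U(ω+ψ)}dN(0,Γ)` (`E_NΣ_Y(ω+ψ)_y² = Σ_Y(Γ_yy + ψ_y²)`). [folklore] -/
theorem blockZ_lower (hΓ : Γ.PosSemidef) (hΓop : (γop • (1 : Matrix ι ι ℝ) - Γ).PosSemidef) (Y : Finset ι)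
    (hUd : ∀ φ : EuclideanSpace ℝ ι, HasFDerivAt U (U' φ) φ) (hκ₀ : 0 ≤ κ₀) (hκu : 0 ≤ κu) (hau : 0 ≤ au) (hτ : 0 < τ) (hδ : 0 < δ)
    (hθ0 : 0 < θ) (hθ1 : θ < 1) (hκθ : (2 * κ₀ * (1 + τ) + 4 * δ) * γop ≤ θ)
    (hstab : ∀ φ : EuclideanSpace ℝ ι, -(κ₀ * ∑ x ∈ Y, φ x ^ 2) ≤ U φ)
    (hUup : ∀ φ : EuclideanSpace ℝ ι, U φ ≤ κu * (au + ∑ x ∈ Y, φ x ^ 2)) (ψ : EuclideanSpace ℝ ι) (hS : ∑ x ∈ Y, ψ x ^ 2 ≤ S) :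
    exp (-(κu * (au + ∑ x ∈ Y, Γ x x + S))) ≤ (∫ ω : EuclideanSpace ℝ ι, exp (-U (ω + ψ)) ∂(multivariateGaussian 0 Γ)) := by
  have hUc : Continuous U := continuous_iff_continuousAt.2 fun φ => (hUd φ).continuousAt
  have hκθ₀ : 2 * κ₀ * (1 + τ) * γop ≤ θ := mul_opBound_le_of_le (by positivity) (by linarith) hθ0.le hκθ
  have hI := integrable_exp_neg_block hΓ hΓop Y hUc.measurable hκ₀ hτ hθ1 hκθ₀ hstab ψ
  obtain ⟨hQ, hUI⟩ := integrable_block_action Γ Y hUc hκ₀ hκu hau hstab hUup ψ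
  -- the Gaussian second moments on `Y`
  have hsq : ∀ x, ∫ ω : EuclideanSpace ℝ ι, (ω + ψ) x ^ 2 ∂(multivariateGaussian 0 Γ) = Γ x x + ψ x ^ 2 := fun x => by
    have e : (fun ω : EuclideanSpace ℝ ι => (ω + ψ) x ^ 2) = fun ω => ω x * ω x + (2 * ψ x) * ω x + ψ x ^ 2 := by
      funext ω; simp only [PiLp.add_apply]; ring
    have iAB : Integrable (fun ω : EuclideanSpace ℝ ι => ω x * ω x + (2 * ψ x) * ω x) (multivariateGaussian 0 Γ) :=
      (integrable_eval_mul_eval Γ x x).add ((integrable_eval Γ x).const_mul _)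
    rw [e, integral_add iAB (integrable_const _), integral_add (integrable_eval_mul_eval Γ x x) ((integrable_eval Γ x).const_mul _),
      integral_const_mul, integral_eval_mul_eval hΓ x x, integral_eval_eq_zero Γ x]
    simp only [mul_zero, add_zero, integral_const, probReal_univ, smul_eq_mul, one_mul]
  have hmean : ∫ ω : EuclideanSpace ℝ ι, (∑ x ∈ Y, (ω + ψ) x ^ 2) ∂(multivariateGaussian 0 Γ) = ∑ x ∈ Y, Γ x x + ∑ x ∈ Y, ψ x ^ 2 := by
    rw [integral_finsetSum Y fun x _ => ?_, ← sum_add_distrib]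
    · exact sum_congr rfl fun x _ => hsq x
    · have e : (fun ω : EuclideanSpace ℝ ι => (ω + ψ) x ^ 2) = fun ω => ω x * ω x + (2 * ψ x) * ω x + ψ x ^ 2 := by
        funext ω; simp only [PiLp.add_apply]; ring
      rw [e]; exact ((integrable_eval_mul_eval Γ x x).add ((integrable_eval Γ x).const_mul _)).add (integrable_const _)
  -- Jensen for `exp` and the mean of `−U(ω+ψ)`
  have hJ := ConvexOn.map_integral_le (μ := (multivariateGaussian 0 Γ)) (s := Set.univ) (g := Real.exp) (f := fun ω : EuclideanSpace ℝ ι => -U (ω + ψ))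
    convexOn_exp Real.continuous_exp.continuousOn isClosed_univ (Filter.Eventually.of_forall fun _ => Set.mem_univ _) hUI.neg hI
  have hlow : -(κu * (au + ∑ x ∈ Y, Γ x x + S)) ≤ ∫ ω : EuclideanSpace ℝ ι, -U (ω + ψ) ∂(multivariateGaussian 0 Γ) := by
    rw [integral_neg]
    have hg : Integrable (fun ω : EuclideanSpace ℝ ι => κu * (au + ∑ x ∈ Y, (ω + ψ) x ^ 2)) (multivariateGaussian 0 Γ) := ((integrable_const au).add hQ).const_mul κu
    have h1 : ∫ ω : EuclideanSpace ℝ ι, U (ω + ψ) ∂(multivariateGaussian 0 Γ) ≤ ∫ ω : EuclideanSpace ℝ ι, κu * (au + ∑ x ∈ Y, (ω + ψ) x ^ 2) ∂(multivariateGaussian 0 Γ) :=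
      integral_mono hUI hg fun ω => hUup (ω + ψ)
    rw [integral_const_mul, integral_add (integrable_const au) hQ, hmean] at h1
    simp only [integral_const, probReal_univ, smul_eq_mul, one_mul] at h1
    nlinarith [mul_le_mul_of_nonneg_left hS hκu]
  exact (exp_le_exp.2 hlow).trans hJ

/-! ## §4. THE END: the moment letters, and (406)'s cubic Taylor letter on the road -/

/-- **THE END — THE BLOCK TILTED GRADIENT-MOMENT LETTERS ON THE ROAD.**  Under the hypotheses of `block_moments_le` and `blockZ_lower`:
at every background `ψ` with `Σ_Yψ² ≤ S`, for `k = 1, 2, 3`, `e^{−U(ω+ψ)}‖U′(ω+ψ)‖ᵏ` is integrable and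
`∫e^{−U(ω+ψ)}‖U′(ω+ψ)‖ᵏ dN(0,Γ) ≤ Z(ψ)·m_k(S)`, `m_k(S) = κ₁ᵏP_k(S)e^{κ₀(1+τ⁻¹)S}·A^{#Y}·e^{κ_u(a_u + Σ_YΓ(y,y) + S)}`. [folklore] -/
theorem block_tilted_gradient_moments (hΓ : Γ.PosSemidef) (hΓop : (γop • (1 : Matrix ι ι ℝ) - Γ).PosSemidef) (Y : Finset ι)
    (hdiag : ∀ i ∈ Y, Γ i i ≤ γ) (hUd : ∀ φ : EuclideanSpace ℝ ι, HasFDerivAt U (U' φ) φ) (hU'c : Continuous U')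
    (hκ₀ : 0 ≤ κ₀) (hκ₁ : 0 ≤ κ₁) (ha : 0 ≤ a) (hκu : 0 ≤ κu) (hau : 0 ≤ au) (hτ : 0 < τ) (hδ : 0 < δ) (hθ0 : 0 < θ) (hθ1 : θ < 1)
    (hκθ : (2 * κ₀ * (1 + τ) + 4 * δ) * γop ≤ θ) (hstab : ∀ φ : EuclideanSpace ℝ ι, -(κ₀ * ∑ x ∈ Y, φ x ^ 2) ≤ U φ)
    (hU'b : ∀ φ : EuclideanSpace ℝ ι, ‖U' φ‖ ≤ κ₁ * (a + ∑ x ∈ Y, φ x ^ 2))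
    (hUup : ∀ φ : EuclideanSpace ℝ ι, U φ ≤ κu * (au + ∑ x ∈ Y, φ x ^ 2)) (ψ : EuclideanSpace ℝ ι) (hS : ∑ x ∈ Y, ψ x ^ 2 ≤ S) :
    (Integrable (fun ω : EuclideanSpace ℝ ι => exp (-U (ω + ψ)) * ‖U' (ω + ψ)‖) (multivariateGaussian 0 Γ) ∧
        (∫ ω : EuclideanSpace ℝ ι, exp (-U (ω + ψ)) * ‖U' (ω + ψ)‖ ∂(multivariateGaussian 0 Γ)) ≤ (∫ ω : EuclideanSpace ℝ ι, exp (-U (ω + ψ)) ∂(multivariateGaussian 0 Γ)) *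
            ((κ₁ * ((a + 2 * S) + δ⁻¹) * exp (κ₀ * (1 + τ⁻¹) * S)) * ((1 - θ) ^ (-((2 * κ₀ * (1 + τ) + 4 * δ) * γ / (2 * θ)))) ^ Y.card * exp (κu * (au + ∑ x ∈ Y, Γ x x +
            S)))) ∧
      (Integrable (fun ω : EuclideanSpace ℝ ι => exp (-U (ω + ψ)) * ‖U' (ω + ψ)‖ ^ 2) (multivariateGaussian 0 Γ) ∧
        (∫ ω : EuclideanSpace ℝ ι, exp (-U (ω + ψ)) * ‖U' (ω + ψ)‖ ^ 2 ∂(multivariateGaussian 0 Γ)) ≤ (∫ ω : EuclideanSpace ℝ ι, exp (-U (ω + ψ)) ∂(multivariateGaussian 0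
            Γ)) * ((κ₁ ^ 2 * (2 * (a + 2 * S) ^ 2 + 8 * (δ ^ 2)⁻¹) * exp (κ₀ * (1 + τ⁻¹) * S)) * ((1 - θ) ^ (-((2 * κ₀ * (1 + τ) + 4 * δ) * γ / (2 * θ)))) ^ Y.card * exp
            (κu * (au + ∑ x ∈ Y, Γ x x + S)))) ∧
      (Integrable (fun ω : EuclideanSpace ℝ ι => exp (-U (ω + ψ)) * ‖U' (ω + ψ)‖ ^ 3) (multivariateGaussian 0 Γ) ∧
        (∫ ω : EuclideanSpace ℝ ι, exp (-U (ω + ψ)) * ‖U' (ω + ψ)‖ ^ 3 ∂(multivariateGaussian 0 Γ)) ≤ (∫ ω : EuclideanSpace ℝ ι, exp (-U (ω + ψ)) ∂(multivariateGaussian 0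
            Γ)) * ((κ₁ ^ 3 * (4 * (a + 2 * S) ^ 3 + 32 * (δ ^ 3)⁻¹) * exp (κ₀ * (1 + τ⁻¹) * S)) * ((1 - θ) ^ (-((2 * κ₀ * (1 + τ) + 4 * δ) * γ / (2 * θ)))) ^ Y.card * exp
            (κu * (au + ∑ x ∈ Y, Γ x x + S)))) := by
  obtain ⟨⟨i1, b1⟩, ⟨i2, b2⟩, ⟨i3, b3⟩⟩ := block_moments_le hΓ hΓop Y hdiag hUd hU'c hκ₀ hκ₁ ha hτ hδ hθ0 hθ1 hκθ hstab hU'b ψ hS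
  have hZ := blockZ_lower hΓ hΓop Y hUd hκ₀ hκu hau hτ hδ hθ0 hθ1 hκθ hstab hUup ψ hS
  -- `K·A ≤ Z·(K·A·e^{L})` since `e^{−L} ≤ Z` and `e^{−L}·e^{L} = 1`
  have lift : ∀ KA : ℝ, 0 ≤ KA → KA ≤ (∫ ω : EuclideanSpace ℝ ι, exp (-U (ω + ψ)) ∂(multivariateGaussian 0 Γ)) * (KA * exp (κu * (au + ∑ x ∈ Y, Γ x x + S))) := fun KA hKA
      =>
    calc KA = exp (-(κu * (au + ∑ x ∈ Y, Γ x x + S))) * (KA * exp (κu * (au + ∑ x ∈ Y, Γ x x + S))) := by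
          rw [mul_left_comm, ← exp_add, neg_add_cancel, exp_zero, mul_one]
      _ ≤ (∫ ω : EuclideanSpace ℝ ι, exp (-U (ω + ψ)) ∂(multivariateGaussian 0 Γ)) * (KA * exp (κu * (au + ∑ x ∈ Y, Γ x x + S))) :=
          mul_le_mul_of_nonneg_right hZ (mul_nonneg hKA (exp_pos _).le)
  have hS0 : 0 ≤ S := (sum_nonneg fun x _ => sq_nonneg (ψ x)).trans hS
  have n1 : 0 ≤ (κ₁ * ((a + 2 * S) + δ⁻¹) * exp (κ₀ * (1 + τ⁻¹) * S)) * ((1 - θ) ^ (-((2 * κ₀ * (1 + τ) + 4 * δ) * γ / (2 * θ)))) ^ Y.card := by positivity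
  have n2 : 0 ≤ (κ₁ ^ 2 * (2 * (a + 2 * S) ^ 2 + 8 * (δ ^ 2)⁻¹) * exp (κ₀ * (1 + τ⁻¹) * S)) * ((1 - θ) ^ (-((2 * κ₀ * (1 + τ) + 4 * δ) * γ / (2 * θ)))) ^ Y.card := by
      positivity
  have n3 : 0 ≤ (κ₁ ^ 3 * (4 * (a + 2 * S) ^ 3 + 32 * (δ ^ 3)⁻¹) * exp (κ₀ * (1 + τ⁻¹) * S)) * ((1 - θ) ^ (-((2 * κ₀ * (1 + τ) + 4 * δ) * γ / (2 * θ)))) ^ Y.card := by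
      positivity
  exact ⟨⟨i1, b1.trans (lift _ n1)⟩, ⟨i2, b2.trans (lift _ n2)⟩, ⟨i3, b3.trans (lift _ n3)⟩⟩

omit [Fintype ι] [DecidableEq ι] in
/-- Along the segment: `Σ_Y(ψ₀ + th)_y² ≤ 2Σ_Yψ₀² + 2Σ_Yh²` for `t ∈ [0,1]`. [folklore] -/
theorem sum_sq_segment_le (Y : Finset ι) (ψ₀ h : EuclideanSpace ℝ ι) {t : ℝ} (ht : t ∈ Icc (0 : ℝ) 1) :
    ∑ x ∈ Y, (ψ₀ + t • h) x ^ 2 ≤ (2 * ∑ x ∈ Y, ψ₀ x ^ 2 + 2 * ∑ x ∈ Y, h x ^ 2) := by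
  have ht2 : t ^ 2 ≤ 1 := by have := ht.1; have := ht.2; nlinarith
  have hpt : ∀ x ∈ Y, (ψ₀ + t • h) x ^ 2 ≤ 2 * ψ₀ x ^ 2 + 2 * h x ^ 2 := fun x _ => by
    simp only [PiLp.add_apply, PiLp.smul_apply, smul_eq_mul]
    nlinarith [sq_nonneg (ψ₀ x - t * h x), sq_nonneg (h x), mul_le_mul_of_nonneg_right ht2 (sq_nonneg (h x))]
  calc ∑ x ∈ Y, (ψ₀ + t • h) x ^ 2 ≤ ∑ x ∈ Y, (2 * ψ₀ x ^ 2 + 2 * h x ^ 2) := sum_le_sum hpt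
    _ = (2 * ∑ x ∈ Y, ψ₀ x ^ 2 + 2 * ∑ x ∈ Y, h x ^ 2) := by rw [sum_add_distrib, mul_sum, mul_sum]

/-- **THE CUBIC TAYLOR LETTER OF THE NEXT POTENTIAL OF A BLOCK INPUT ON THE ROAD — THE MOMENT LETTERS DISCHARGED.**  Under (405)'s
hypotheses (`C³` block `U` with the four block letters, regulator margins), `Γ(y,y) ≤ γ` on `Y` and the upper growth letter
`U ≤ κ_u(a_u + Σ_Yφ²)`: (406)'s three Taylor remainders of `t ↦ log Z(ψ₀ + th)` between `0` and `1` are at most `‖h‖³𝔪∕6`, `‖h‖³𝔪∕2`, `‖h‖³𝔪`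
with `𝔪 = (m₃ + 3κ₂m₁ + κ₃) + 3m₁(m₂ + κ₂) + 2m₁³` at `m_k = m_k(2Σ_Yψ₀² + 2Σ_Yh²)` — NO moment hypothesis left. [folklore] -/
theorem block_cubic_taylor_road (hΓ : Γ.PosSemidef) (hΓop : (γop • (1 : Matrix ι ι ℝ) - Γ).PosSemidef) (Y : Finset ι)
    (hdiag : ∀ i ∈ Y, Γ i i ≤ γ)
    (hUd : ∀ φ : EuclideanSpace ℝ ι, HasFDerivAt U (U' φ) φ) (hU'd : ∀ φ : EuclideanSpace ℝ ι, HasFDerivAt U' (U'' φ) φ)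
    (hU''d : ∀ φ : EuclideanSpace ℝ ι, HasFDerivAt U'' (U₃ φ) φ) (hU₃c : Continuous U₃)
    (hκ₀ : 0 ≤ κ₀) (hκ₁ : 0 ≤ κ₁) (ha : 0 ≤ a) (hκ₂ : 0 ≤ κ₂) (hκ₃ : 0 ≤ κ₃) (hκu : 0 ≤ κu) (hau : 0 ≤ au) (hτ : 0 < τ) (hδ : 0 < δ)
    (hθ0 : 0 < θ) (hθ1 : θ < 1) (hκθ : (2 * κ₀ * (1 + τ) + 4 * δ) * γop ≤ θ)
    (hstab : ∀ φ : EuclideanSpace ℝ ι, -(κ₀ * ∑ x ∈ Y, φ x ^ 2) ≤ U φ)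
    (hU'b : ∀ φ : EuclideanSpace ℝ ι, ‖U' φ‖ ≤ κ₁ * (a + ∑ x ∈ Y, φ x ^ 2)) (hU''b : ∀ φ : EuclideanSpace ℝ ι, ‖U'' φ‖ ≤ κ₂)
    (hU₃b : ∀ φ : EuclideanSpace ℝ ι, ‖U₃ φ‖ ≤ κ₃) (hUup : ∀ φ : EuclideanSpace ℝ ι, U φ ≤ κu * (au + ∑ x ∈ Y, φ x ^ 2))
    (ψ₀ h : EuclideanSpace ℝ ι) :
    |Real.log (∫ ω : EuclideanSpace ℝ ι, exp (-U (ω + (ψ₀ + (1 : ℝ) • h))) ∂(multivariateGaussian 0 Γ)) - Real.log (∫ ω : EuclideanSpace ℝ ι, exp (-U (ω + (ψ₀ + (0 : ℝ) •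
        h))) ∂(multivariateGaussian 0 Γ)) - (∫ ω : EuclideanSpace ℝ ι, exp (-U (ω + (ψ₀ + (0 : ℝ) • h))) * -(U' (ω + (ψ₀ + (0 : ℝ) • h)) h) ∂(multivariateGaussian 0 Γ)) /
        (∫ ω : EuclideanSpace ℝ ι, exp (-U (ω + (ψ₀ + (0 : ℝ) • h))) ∂(multivariateGaussian 0 Γ)) - ((∫ ω : EuclideanSpace ℝ ι, exp (-U (ω + (ψ₀ + (0 : ℝ) • h))) * (U' (ω +
        (ψ₀ + (0 : ℝ) • h)) h * U' (ω + (ψ₀ + (0 : ℝ) • h)) h - U'' (ω + (ψ₀ + (0 : ℝ) • h)) h h) ∂(multivariateGaussian 0 Γ)) * (∫ ω : EuclideanSpace ℝ ι, exp (-U (ω + (ψ₀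
        + (0 : ℝ) • h))) ∂(multivariateGaussian 0 Γ)) - (∫ ω : EuclideanSpace ℝ ι, exp (-U (ω + (ψ₀ + (0 : ℝ) • h))) * -(U' (ω + (ψ₀ + (0 : ℝ) • h)) h)
        ∂(multivariateGaussian 0 Γ)) * (∫ ω : EuclideanSpace ℝ ι, exp (-U (ω + (ψ₀ + (0 : ℝ) • h))) * -(U' (ω + (ψ₀ + (0 : ℝ) • h)) h) ∂(multivariateGaussian 0 Γ))) / (∫ ω
        : EuclideanSpace ℝ ι, exp (-U (ω + (ψ₀ + (0 : ℝ) • h))) ∂(multivariateGaussian 0 Γ)) ^ 2 / 2| ≤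
        ‖h‖ ^ 3 * ((((κ₁ ^ 3 * (4 * (a + 2 * (2 * ∑ x ∈ Y, ψ₀ x ^ 2 + 2 * ∑ x ∈ Y, h x ^ 2)) ^ 3 + 32 * (δ ^ 3)⁻¹) * exp (κ₀ * (1 + τ⁻¹) * (2 * ∑ x ∈ Y, ψ₀ x ^ 2 + 2 * ∑ x
            ∈ Y, h x ^ 2))) * ((1 - θ) ^ (-((2 * κ₀ * (1 + τ) + 4 * δ) * γ / (2 * θ)))) ^ Y.card * exp (κu * (au + ∑ x ∈ Y, Γ x x + (2 * ∑ x ∈ Y, ψ₀ x ^ 2 + 2 * ∑ x ∈ Y, h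
            x ^ 2)))) + 3 * κ₂ * ((κ₁ * ((a + 2 * (2 * ∑ x ∈ Y, ψ₀ x ^ 2 + 2 * ∑ x ∈ Y, h x ^ 2)) + δ⁻¹) * exp (κ₀ * (1 + τ⁻¹) * (2 * ∑ x ∈ Y, ψ₀ x ^ 2 + 2 * ∑ x ∈ Y, h x ^
            2))) * ((1 - θ) ^ (-((2 * κ₀ * (1 + τ) + 4 * δ) * γ / (2 * θ)))) ^ Y.card * exp (κu * (au + ∑ x ∈ Y, Γ x x + (2 * ∑ x ∈ Y, ψ₀ x ^ 2 + 2 * ∑ x ∈ Y, h x ^ 2)))) +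
            κ₃) + 3 * ((κ₁ * ((a + 2 * (2 * ∑ x ∈ Y, ψ₀ x ^ 2 + 2 * ∑ x ∈ Y, h x ^ 2)) + δ⁻¹) * exp (κ₀ * (1 + τ⁻¹) * (2 * ∑ x ∈ Y, ψ₀ x ^ 2 + 2 * ∑ x ∈ Y, h x ^ 2))) * ((1
            - θ) ^ (-((2 * κ₀ * (1 + τ) + 4 * δ) * γ / (2 * θ)))) ^ Y.card * exp (κu * (au + ∑ x ∈ Y, Γ x x + (2 * ∑ x ∈ Y, ψ₀ x ^ 2 + 2 * ∑ x ∈ Y, h x ^ 2)))) * (((κ₁ ^ 2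
            * (2 * (a + 2 * (2 * ∑ x ∈ Y, ψ₀ x ^ 2 + 2 * ∑ x ∈ Y, h x ^ 2)) ^ 2 + 8 * (δ ^ 2)⁻¹) * exp (κ₀ * (1 + τ⁻¹) * (2 * ∑ x ∈ Y, ψ₀ x ^ 2 + 2 * ∑ x ∈ Y, h x ^ 2))) *
            ((1 - θ) ^ (-((2 * κ₀ * (1 + τ) + 4 * δ) * γ / (2 * θ)))) ^ Y.card * exp (κu * (au + ∑ x ∈ Y, Γ x x + (2 * ∑ x ∈ Y, ψ₀ x ^ 2 + 2 * ∑ x ∈ Y, h x ^ 2)))) + κ₂) +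
            2 * ((κ₁ * ((a + 2 * (2 * ∑ x ∈ Y, ψ₀ x ^ 2 + 2 * ∑ x ∈ Y, h x ^ 2)) + δ⁻¹) * exp (κ₀ * (1 + τ⁻¹) * (2 * ∑ x ∈ Y, ψ₀ x ^ 2 + 2 * ∑ x ∈ Y, h x ^ 2))) * ((1 - θ)
            ^ (-((2 * κ₀ * (1 + τ) + 4 * δ) * γ / (2 * θ)))) ^ Y.card * exp (κu * (au + ∑ x ∈ Y, Γ x x + (2 * ∑ x ∈ Y, ψ₀ x ^ 2 + 2 * ∑ x ∈ Y, h x ^ 2)))) ^ 3) / 6 ∧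
      |(∫ ω : EuclideanSpace ℝ ι, exp (-U (ω + (ψ₀ + (1 : ℝ) • h))) * -(U' (ω + (ψ₀ + (1 : ℝ) • h)) h) ∂(multivariateGaussian 0 Γ)) / (∫ ω : EuclideanSpace ℝ ι, exp (-U (ω
          + (ψ₀ + (1 : ℝ) • h))) ∂(multivariateGaussian 0 Γ)) - (∫ ω : EuclideanSpace ℝ ι, exp (-U (ω + (ψ₀ + (0 : ℝ) • h))) * -(U' (ω + (ψ₀ + (0 : ℝ) • h)) h)
          ∂(multivariateGaussian 0 Γ)) / (∫ ω : EuclideanSpace ℝ ι, exp (-U (ω + (ψ₀ + (0 : ℝ) • h))) ∂(multivariateGaussian 0 Γ)) - ((∫ ω : EuclideanSpace ℝ ι, exp (-U (ω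
          + (ψ₀ + (0 : ℝ) • h))) * (U' (ω + (ψ₀ + (0 : ℝ) • h)) h * U' (ω + (ψ₀ + (0 : ℝ) • h)) h - U'' (ω + (ψ₀ + (0 : ℝ) • h)) h h) ∂(multivariateGaussian 0 Γ)) * (∫ ω :
          EuclideanSpace ℝ ι, exp (-U (ω + (ψ₀ + (0 : ℝ) • h))) ∂(multivariateGaussian 0 Γ)) - (∫ ω : EuclideanSpace ℝ ι, exp (-U (ω + (ψ₀ + (0 : ℝ) • h))) * -(U' (ω + (ψ₀
          + (0 : ℝ) • h)) h) ∂(multivariateGaussian 0 Γ)) * (∫ ω : EuclideanSpace ℝ ι, exp (-U (ω + (ψ₀ + (0 : ℝ) • h))) * -(U' (ω + (ψ₀ + (0 : ℝ) • h)) h)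
          ∂(multivariateGaussian 0 Γ))) / (∫ ω : EuclideanSpace ℝ ι, exp (-U (ω + (ψ₀ + (0 : ℝ) • h))) ∂(multivariateGaussian 0 Γ)) ^ 2| ≤
        ‖h‖ ^ 3 * ((((κ₁ ^ 3 * (4 * (a + 2 * (2 * ∑ x ∈ Y, ψ₀ x ^ 2 + 2 * ∑ x ∈ Y, h x ^ 2)) ^ 3 + 32 * (δ ^ 3)⁻¹) * exp (κ₀ * (1 + τ⁻¹) * (2 * ∑ x ∈ Y, ψ₀ x ^ 2 + 2 * ∑ x
            ∈ Y, h x ^ 2))) * ((1 - θ) ^ (-((2 * κ₀ * (1 + τ) + 4 * δ) * γ / (2 * θ)))) ^ Y.card * exp (κu * (au + ∑ x ∈ Y, Γ x x + (2 * ∑ x ∈ Y, ψ₀ x ^ 2 + 2 * ∑ x ∈ Y, h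
            x ^ 2)))) + 3 * κ₂ * ((κ₁ * ((a + 2 * (2 * ∑ x ∈ Y, ψ₀ x ^ 2 + 2 * ∑ x ∈ Y, h x ^ 2)) + δ⁻¹) * exp (κ₀ * (1 + τ⁻¹) * (2 * ∑ x ∈ Y, ψ₀ x ^ 2 + 2 * ∑ x ∈ Y, h x ^
            2))) * ((1 - θ) ^ (-((2 * κ₀ * (1 + τ) + 4 * δ) * γ / (2 * θ)))) ^ Y.card * exp (κu * (au + ∑ x ∈ Y, Γ x x + (2 * ∑ x ∈ Y, ψ₀ x ^ 2 + 2 * ∑ x ∈ Y, h x ^ 2)))) +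
            κ₃) + 3 * ((κ₁ * ((a + 2 * (2 * ∑ x ∈ Y, ψ₀ x ^ 2 + 2 * ∑ x ∈ Y, h x ^ 2)) + δ⁻¹) * exp (κ₀ * (1 + τ⁻¹) * (2 * ∑ x ∈ Y, ψ₀ x ^ 2 + 2 * ∑ x ∈ Y, h x ^ 2))) * ((1
            - θ) ^ (-((2 * κ₀ * (1 + τ) + 4 * δ) * γ / (2 * θ)))) ^ Y.card * exp (κu * (au + ∑ x ∈ Y, Γ x x + (2 * ∑ x ∈ Y, ψ₀ x ^ 2 + 2 * ∑ x ∈ Y, h x ^ 2)))) * (((κ₁ ^ 2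
            * (2 * (a + 2 * (2 * ∑ x ∈ Y, ψ₀ x ^ 2 + 2 * ∑ x ∈ Y, h x ^ 2)) ^ 2 + 8 * (δ ^ 2)⁻¹) * exp (κ₀ * (1 + τ⁻¹) * (2 * ∑ x ∈ Y, ψ₀ x ^ 2 + 2 * ∑ x ∈ Y, h x ^ 2))) *
            ((1 - θ) ^ (-((2 * κ₀ * (1 + τ) + 4 * δ) * γ / (2 * θ)))) ^ Y.card * exp (κu * (au + ∑ x ∈ Y, Γ x x + (2 * ∑ x ∈ Y, ψ₀ x ^ 2 + 2 * ∑ x ∈ Y, h x ^ 2)))) + κ₂) +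
            2 * ((κ₁ * ((a + 2 * (2 * ∑ x ∈ Y, ψ₀ x ^ 2 + 2 * ∑ x ∈ Y, h x ^ 2)) + δ⁻¹) * exp (κ₀ * (1 + τ⁻¹) * (2 * ∑ x ∈ Y, ψ₀ x ^ 2 + 2 * ∑ x ∈ Y, h x ^ 2))) * ((1 - θ)
            ^ (-((2 * κ₀ * (1 + τ) + 4 * δ) * γ / (2 * θ)))) ^ Y.card * exp (κu * (au + ∑ x ∈ Y, Γ x x + (2 * ∑ x ∈ Y, ψ₀ x ^ 2 + 2 * ∑ x ∈ Y, h x ^ 2)))) ^ 3) / 2 ∧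
      |((∫ ω : EuclideanSpace ℝ ι, exp (-U (ω + (ψ₀ + (1 : ℝ) • h))) * (U' (ω + (ψ₀ + (1 : ℝ) • h)) h * U' (ω + (ψ₀ + (1 : ℝ) • h)) h - U'' (ω + (ψ₀ + (1 : ℝ) • h)) h h)
          ∂(multivariateGaussian 0 Γ)) * (∫ ω : EuclideanSpace ℝ ι, exp (-U (ω + (ψ₀ + (1 : ℝ) • h))) ∂(multivariateGaussian 0 Γ)) - (∫ ω : EuclideanSpace ℝ ι, exp (-U (ω +
          (ψ₀ + (1 : ℝ) • h))) * -(U' (ω + (ψ₀ + (1 : ℝ) • h)) h) ∂(multivariateGaussian 0 Γ)) * (∫ ω : EuclideanSpace ℝ ι, exp (-U (ω + (ψ₀ + (1 : ℝ) • h))) * -(U' (ω +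
          (ψ₀ + (1 : ℝ) • h)) h) ∂(multivariateGaussian 0 Γ))) / (∫ ω : EuclideanSpace ℝ ι, exp (-U (ω + (ψ₀ + (1 : ℝ) • h))) ∂(multivariateGaussian 0 Γ)) ^ 2 - ((∫ ω :
          EuclideanSpace ℝ ι, exp (-U (ω + (ψ₀ + (0 : ℝ) • h))) * (U' (ω + (ψ₀ + (0 : ℝ) • h)) h * U' (ω + (ψ₀ + (0 : ℝ) • h)) h - U'' (ω + (ψ₀ + (0 : ℝ) • h)) h h)
          ∂(multivariateGaussian 0 Γ)) * (∫ ω : EuclideanSpace ℝ ι, exp (-U (ω + (ψ₀ + (0 : ℝ) • h))) ∂(multivariateGaussian 0 Γ)) - (∫ ω : EuclideanSpace ℝ ι, exp (-U (ω +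
          (ψ₀ + (0 : ℝ) • h))) * -(U' (ω + (ψ₀ + (0 : ℝ) • h)) h) ∂(multivariateGaussian 0 Γ)) * (∫ ω : EuclideanSpace ℝ ι, exp (-U (ω + (ψ₀ + (0 : ℝ) • h))) * -(U' (ω +
          (ψ₀ + (0 : ℝ) • h)) h) ∂(multivariateGaussian 0 Γ))) / (∫ ω : EuclideanSpace ℝ ι, exp (-U (ω + (ψ₀ + (0 : ℝ) • h))) ∂(multivariateGaussian 0 Γ)) ^ 2| ≤
        ‖h‖ ^ 3 * ((((κ₁ ^ 3 * (4 * (a + 2 * (2 * ∑ x ∈ Y, ψ₀ x ^ 2 + 2 * ∑ x ∈ Y, h x ^ 2)) ^ 3 + 32 * (δ ^ 3)⁻¹) * exp (κ₀ * (1 + τ⁻¹) * (2 * ∑ x ∈ Y, ψ₀ x ^ 2 + 2 * ∑ x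
            ∈ Y, h x ^ 2))) * ((1 - θ) ^ (-((2 * κ₀ * (1 + τ) + 4 * δ) * γ / (2 * θ)))) ^ Y.card * exp (κu * (au + ∑ x ∈ Y, Γ x x + (2 * ∑ x ∈ Y, ψ₀ x ^ 2 + 2 * ∑ x ∈ Y, h
            x ^ 2)))) + 3 * κ₂ * ((κ₁ * ((a + 2 * (2 * ∑ x ∈ Y, ψ₀ x ^ 2 + 2 * ∑ x ∈ Y, h x ^ 2)) + δ⁻¹) * exp (κ₀ * (1 + τ⁻¹) * (2 * ∑ x ∈ Y, ψ₀ x ^ 2 + 2 * ∑ x ∈ Y, h x ^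
            2))) * ((1 - θ) ^ (-((2 * κ₀ * (1 + τ) + 4 * δ) * γ / (2 * θ)))) ^ Y.card * exp (κu * (au + ∑ x ∈ Y, Γ x x + (2 * ∑ x ∈ Y, ψ₀ x ^ 2 + 2 * ∑ x ∈ Y, h x ^ 2)))) +
            κ₃) + 3 * ((κ₁ * ((a + 2 * (2 * ∑ x ∈ Y, ψ₀ x ^ 2 + 2 * ∑ x ∈ Y, h x ^ 2)) + δ⁻¹) * exp (κ₀ * (1 + τ⁻¹) * (2 * ∑ x ∈ Y, ψ₀ x ^ 2 + 2 * ∑ x ∈ Y, h x ^ 2))) * ((1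
            - θ) ^ (-((2 * κ₀ * (1 + τ) + 4 * δ) * γ / (2 * θ)))) ^ Y.card * exp (κu * (au + ∑ x ∈ Y, Γ x x + (2 * ∑ x ∈ Y, ψ₀ x ^ 2 + 2 * ∑ x ∈ Y, h x ^ 2)))) * (((κ₁ ^ 2
            * (2 * (a + 2 * (2 * ∑ x ∈ Y, ψ₀ x ^ 2 + 2 * ∑ x ∈ Y, h x ^ 2)) ^ 2 + 8 * (δ ^ 2)⁻¹) * exp (κ₀ * (1 + τ⁻¹) * (2 * ∑ x ∈ Y, ψ₀ x ^ 2 + 2 * ∑ x ∈ Y, h x ^ 2))) *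
            ((1 - θ) ^ (-((2 * κ₀ * (1 + τ) + 4 * δ) * γ / (2 * θ)))) ^ Y.card * exp (κu * (au + ∑ x ∈ Y, Γ x x + (2 * ∑ x ∈ Y, ψ₀ x ^ 2 + 2 * ∑ x ∈ Y, h x ^ 2)))) + κ₂) +
            2 * ((κ₁ * ((a + 2 * (2 * ∑ x ∈ Y, ψ₀ x ^ 2 + 2 * ∑ x ∈ Y, h x ^ 2)) + δ⁻¹) * exp (κ₀ * (1 + τ⁻¹) * (2 * ∑ x ∈ Y, ψ₀ x ^ 2 + 2 * ∑ x ∈ Y, h x ^ 2))) * ((1 - θ)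
            ^ (-((2 * κ₀ * (1 + τ) + 4 * δ) * γ / (2 * θ)))) ^ Y.card * exp (κu * (au + ∑ x ∈ Y, Γ x x + (2 * ∑ x ∈ Y, ψ₀ x ^ 2 + 2 * ∑ x ∈ Y, h x ^ 2)))) ^ 3) := by
  have hU'c : Continuous U' := continuous_iff_continuousAt.2 fun φ => (hU'd φ).continuousAt
  have hm := fun (t : ℝ) (ht : t ∈ Icc (0 : ℝ) 1) => block_tilted_gradient_moments hΓ hΓop Y hdiag hUd hU'c hκ₀ hκ₁ ha hκu hau hτ hδ hθ0 hθ1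
    hκθ hstab hU'b hUup (ψ₀ + t • h) (sum_sq_segment_le Y ψ₀ h ht)
  exact block_cubic_taylor hΓ hΓop Y hUd hU'd hU''d hU₃c hκ₀ hκ₁ ha hκ₂ hκ₃ hτ hδ hθ0 hθ1 hκθ hstab hU'b hU''b hU₃b ψ₀ h
    (fun t ht => (hm t ht).1.1) (fun t ht => (hm t ht).1.2) (fun t ht => (hm t ht).2.1.1) (fun t ht => (hm t ht).2.1.2)
    (fun t ht => (hm t ht).2.2.1) (fun t ht => (hm t ht).2.2.2)

end Main

/-- Toy (§1): `S² ≤ 1⁻²e^{2S}` at `δ = 1`. -/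
example (S : ℝ) (hS : 0 ≤ S) : S ^ 2 ≤ ((1 : ℝ) ^ 2)⁻¹ * exp (2 * 1 * S) := sq_le_exp one_pos hS

end Summit.QuantumFields.BalabanUV.T4Continuum.NE7b.SupBlockTiltedGradientMoments
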